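import Literature.Analysis.FluidPDE.SereginEpsilonRegularityHigher
import Literature.Analysis.FluidPDE.SuitableWeakInBallTools
import Literature.Analysis.FluidPDE.SereginSverakOffAxisEpsilon
import Literature.Analysis.FluidPDE.NSBoundedInteriorRegularity
import Literature.Analysis.FluidPDE.AxisymmetricVorticityTransport
import HarnessLib

/-!
# Seregin–Šverák 2009: off the axis (indeed below the final time) Type I axially symmetric
# solutions are "sufficiently smooth" — `OffAxisSmoothRepresentative` from Seregin's Lemma 6.1

Proofs-only companion (no definitions) of `SereginSverakOffAxisInputs.lean`, whose named fact
`SereginSverak2009.OffAxisSmoothRepresentative` — every pair of the unit-scale class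
`IsTypeIAxisymmetricSolutionOn 3` (Seregin–Šverák 2009, arXiv:0804.1803, the conditions of
Thm. 3.1 transported to `Q(0,3)`: distributional solution, `u ∈ L³`, `p ∈ L^{3/2}`, axially
symmetric slices, Type I bound (r3) `√(-t)|u| ≤ C` a.e.) has, on the shell
`Q̃ = 𝒞(1/4,3;2) × ]-2²,0[` of Seregin–Zajaczkowski 2007, Prop. 4.1, a representative `V` in the
hypothesis class `SereginZajaczkowski2007.IsSmoothAxisymmetricSolutionOn` of that proposition
(suitable weak solution, axially symmetric, `C^∞` slices, all spatial derivatives locally Hölder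
continuous in space–time) — is PROVED here from two accepted named facts:

`SereginSverak2009.offAxisSmoothRepresentative_of :
    seregin_sverak_pressure_decay → seregin2014_lemma61 → OffAxisSmoothRepresentative`

(`seregin_sverak_pressure_decay`, `PressureDecayEstimate.lean`, is itself a theorem of the tree,
`seregin_sverak_pressure_decay_holds` of `PressureDecayEstimateProofs.lean`; the unconditional
corollary is recorded in `SereginSverakOffAxisAssembly.lean`, which imports that proof).

The source asserts this regularity in §2, p. 8 ("Our solution `v` and `q` has good properties
inside `Q₁` [the region where `v` is essentially bounded] … for any natural `k`,
`z = (x,t) ↦ ∇ᵏv(z)` is Hölder continuous in `Q̄₂` … Proof of this statements can be done by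
induction and founded in [ESS4], [LS], and [NRS]") and uses it, with Remark 3.4, to apply
Prop. 4.1 of [S11] = Seregin–Zajaczkowski 2007 in the proof of Prop. 3.7 ((as15), p. 10). Here
it is derived from the ε-regularity lemma WITH ALL DERIVATIVES, Seregin 2014, Ch. 6, Lemma 6.1
(`seregin2014_lemma61`, `SereginEpsilonRegularityHigher.lean`; = [ESS4] Lemma 2.2), through the
smallness of `C + D` at small scales around every point below the final time:

* *Boundedness below the final time.* (r3) gives `|u| ≤ M` a.e. on every closed box
  `K = [t₀-δ², t₀+δ²] × B̄(x₀, δ)` inside `Q(0,3) ∩ {t < t₀/2}` (`ae_norm_le_of_typeI`), hence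
  `C(r; z₁) ≤ |B₁| M³ r³` for the cylinders `Q_r(z₁) ⊆ K` (`cknC_le_of_ae_bound`).
* *The decay estimate for the pressure, iterated* (SZ2007, proof of Lemma 2.3, p. 3; SS2009
  p. 10): at a fixed centre `z₁` and along `r_k = σ^{2k}R₀` with `cσ² ≤ 1/2`, the accepted
  majorant bookkeeping of `SereginSverakOffAxisInputs.lean` (`decayMajorant`, `decay_step_ennreal`,
  `exists_decayMajorant_add_le`) gives `D(r_k; z₁) ≤ g_k` and `C + D ≤ ε₀/2` at some index `k`
  depending only on `(c, σ, M, R₀, ∫_K |p|^{3/2}, ε₀)` (`cknD_le_decayMajorant`,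
  `cknC_add_cknD_le_of_index`) — uniformly in the centres `z₁ = (t₁, x₀)`, `t₁ ∈ [t₀, t₀ + δ²]`,
  `R₀ = δ/2`.
* *Lemma 6.1 at the scale `r = r_k`, centre `z₁ = (t₀ + r²/8, x₀)`*: the pair is a suitable weak
  solution on `Q(0,3)` (Remark 3.4, `SuitableOfBounded_holds`, `IsTypeIAxisymmetricSolutionOn.isSuitable`),
  hence in the class `IsSuitableWeakSolutionInBall r z₁` (closed box inside `Q(0,3)`), its zoom to
  `Q(0,1)` satisfies (6.1.5) (`IsSuitableWeakSolutionInBall.zoom`, `lintegral_cube_zoom`,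
  `lintegral_pressure_zoom`), Lemma 6.1 yields the smooth representative on `Q(0,1/2)`, and
  `exists_representative_of_zoom` transports it to `Q(z₁, r/2) ∋ z₀`
  (`exists_local_smooth_representative`).
* *Gluing and symmetry.* The local representatives are continuous, so they glue to a continuous
  `v` on `Q̃` (accepted `exists_continuousOn_ae_eq_of_locally`) which coincides with each of them
  on its (open) domain; smoothness of slices and local Hölder continuity of the derivatives pass
  along these identities; `v` is axially symmetric at the points of `Q̃` because `u` is, slice by
  slice, the rotations `(t, x) ↦ (t, R_θ x)` preserve Lebesgue measure and `Q̃`, and continuous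
  functions a.e. equal on an open set are equal (`isAxisymmetricOn_of_ae_eq`); suitability passes
  to the a.e.-equal pair (`IsSuitableWeakSolutionOn.congr_ae`).

## References

* G. Seregin, V. Šverák, Comm. PDE 34 (2009) 171–201, arXiv:0804.1803: §2 p. 6 ((b8)–(b10)),
  p. 8 (regularity inside `Q₁`), §3 p. 9 (Thm. 3.1, (r3), Remark 3.4), proof of Prop. 3.7
  (as15) (p. 10). [`SereginSverak2009`]
* G. Seregin, W. Zajaczkowski, SIAM J. Math. Anal. 39 (2007), arXiv:math/0702720: proof of
  Lemma 2.3 (p. 3), Prop. 4.1 (p. 5). [`SereginZajaczkowski2007`]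
* G. Seregin, *Lecture Notes on Regularity Theory for the Navier–Stokes Equations*, World
  Scientific 2014, Ch. 6, §6.1, Lemma 6.1 (p. 90), "Lemma 6.1 and the Navier–Stokes scaling"
  (p. 100). [`Seregin2014`]
* L. Escauriaza, G. Seregin, V. Šverák, Russ. Math. Surveys 58:2 (2003), Lemma 2.2 ([ESS4]).
  [`EscauriazaSereginSverak2003`]
-/

noncomputable section

open MeasureTheory Set Function Filter Topology TopologicalSpace Module Metric
open scoped NNReal ENNReal ContDiff

namespace Literature.Analysis.FluidPDE

namespace SereginSverak2009

open SereginZajaczkowski2007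

variable {u : ℝ → EuclideanSpace ℝ (Fin 3) → EuclideanSpace ℝ (Fin 3)} {p : ℝ → EuclideanSpace ℝ (Fin 3) → ℝ}

/-! ### The decay iteration at a fixed centre, general starting radius -/

section Iteration

/-- The ratios of the consecutive radii `r = σ² r₁`: `r/r₁ = σ²`, `(r₁/r)² = σ⁻⁴`. [folklore] -/
theorem radius_ratios {σ r₁ : ℝ} (hσ : 0 < σ) (hr : 0 < r₁) :
    σ ^ 2 * r₁ / r₁ = σ ^ 2 ∧ (r₁ / (σ ^ 2 * r₁)) ^ 2 = (σ ^ 4)⁻¹ := by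
  constructor
  · field_simp
  · field_simp

/-- The radii `r_k = σ^{2k} R₀` of the iteration: `r_{k+1} = σ² r_k`, `0 < r_k ≤ R₀` (`σ ≤ 1`). [folklore] -/
theorem radius_succ (σ R₀ : ℝ) (k : ℕ) : (σ ^ (k + 1)) ^ 2 * R₀ = σ ^ 2 * ((σ ^ k) ^ 2 * R₀) := by
  ring

/-- `0 < r_k ≤ R₀`. [folklore] -/
theorem radius_pos_le {σ R₀ : ℝ} (hσ0 : 0 < σ) (hσ1 : σ ≤ 1) (hR₀ : 0 < R₀) (k : ℕ) :
    0 < (σ ^ k) ^ 2 * R₀ ∧ (σ ^ k) ^ 2 * R₀ ≤ R₀ := by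
  have h1 : (σ ^ k) ^ 2 ≤ 1 := pow_le_one₀ (by positivity) (pow_le_one₀ hσ0.le hσ1)
  exact ⟨by positivity, by nlinarith⟩

/-- **The decay estimate for the pressure, iterated at a fixed centre** (Seregin–Zajaczkowski
2007, proof of Lemma 2.3, arXiv p. 3: "The latter inequality may be easily iterated"; Seregin–Šverák
2009, p. 10), general starting radius `R₀`: if `D(ϱ) ≤ c[(ϱ/r)D(r) + (r/ϱ)²C(r)]` holds for the
cylinders `Q_r(z₁) ⊆ S` (the decay estimate (2.2)/(as13), ball form), `Q_{R₀}(z₁) ⊆ S`,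
`cσ² ≤ 1/2`, `D(R₀; z₁) ≤ D₀` and `C(σ^{2k}R₀; z₁) ≤ a s_k` (`s_k = σ^k/2`) for all `k`, then
`D(σ^{2k}R₀; z₁) ≤ g_k` for the explicit majorant `g = decayMajorant c σ a D₀`
(`g₀ = D₀`, `g_{k+1} = g_k/2 + cσ⁻⁴ a s_k`). [cite: SereginZajaczkowski2007, proof of Lemma 2.3 (arXiv p. 3)] -/
theorem cknD_le_decayMajorant {S : Set (ℝ × EuclideanSpace ℝ (Fin 3))} {c : ℝ≥0}
    (h22 : ∀ (z : ℝ × EuclideanSpace ℝ (Fin 3)) (r ϱ : ℝ), 0 < ϱ → ϱ ≤ r → parabolicCylinder r z ⊆ S →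
      cknD ϱ z p ≤ c * (ENNReal.ofReal (ϱ / r) * cknD r z p + ENNReal.ofReal ((r / ϱ) ^ 2) * cknC r z u))
    {z₁ : ℝ × EuclideanSpace ℝ (Fin 3)} {R₀ : ℝ} (hR₀ : 0 < R₀) (hsub : parabolicCylinder R₀ z₁ ⊆ S)
    {σ : ℝ≥0} (hσ0 : 0 < σ) (hσ1 : σ < 1) (hcσ : c * σ ^ 2 ≤ 1 / 2) {a D₀ : ℝ≥0}
    (hD : cknD R₀ z₁ p ≤ D₀)
    (hC : ∀ k : ℕ, cknC (((σ : ℝ) ^ k) ^ 2 * R₀) z₁ u ≤ ((a * epsHalfScale σ k : ℝ≥0) : ℝ≥0∞)) :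
    ∀ k : ℕ, cknD (((σ : ℝ) ^ k) ^ 2 * R₀) z₁ p ≤ (decayMajorant c σ a D₀ k : ℝ≥0∞) := by
  have hσR : (0 : ℝ) < σ := by exact_mod_cast hσ0
  have hσ1R : (σ : ℝ) ≤ 1 := by exact_mod_cast hσ1.le
  intro k
  induction k with
  | zero =>
    simp only [pow_zero, one_pow, one_mul]
    simpa [decayMajorant] using hD
  | succ k ih =>
    obtain ⟨hrk, hrkR⟩ := radius_pos_le hσR hσ1R hR₀ k
    set r₁ : ℝ := ((σ : ℝ) ^ k) ^ 2 * R₀ with hr₁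
    have hsub₁ : parabolicCylinder r₁ z₁ ⊆ S := by
      refine Subset.trans (prod_mono (Ioo_subset_Ioo ?_ le_rfl) (ball_subset_ball hrkR)) hsub
      nlinarith [pow_le_pow_left₀ hrk.le hrkR 2]
    have hle : (σ : ℝ) ^ 2 * r₁ ≤ r₁ := by
      have : (σ : ℝ) ^ 2 ≤ 1 := pow_le_one₀ hσR.le hσ1R
      nlinarith
    have h := h22 z₁ r₁ ((σ : ℝ) ^ 2 * r₁) (by positivity) hle hsub₁
    obtain ⟨e1, e2⟩ := radius_ratios hσR hrk
    rw [e1, e2, show ENNReal.ofReal ((σ : ℝ) ^ 2) = ((σ ^ 2 : ℝ≥0) : ℝ≥0∞) by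
        rw [← NNReal.coe_pow, ENNReal.ofReal_coe_nnreal],
      show ENNReal.ofReal (((σ : ℝ) ^ 4)⁻¹) = (((σ ^ 4)⁻¹ : ℝ≥0) : ℝ≥0∞) by
        rw [← NNReal.coe_pow, ← NNReal.coe_inv, ENNReal.ofReal_coe_nnreal]] at h
    rw [radius_succ, decayMajorant_succ]
    exact decay_step_ennreal hcσ h ih (hC k)

/-- **Smallness at some scale.** Under the hypotheses of `cknD_le_decayMajorant` (`σ < 1`), for
every `η > 0` there is an index `k` with `C(σ^{2k}R₀; z₁) + D(σ^{2k}R₀; z₁) ≤ η`; the index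
depends only on the data `(c, σ, a, D₀, η)` ("Given `ε > 0`, we can find an integer number `k₀`
so that … `≤ ε`", SZ2007 p. 3). [cite: SereginZajaczkowski2007, proof of Lemma 2.3 (arXiv p. 3)] -/
theorem cknC_add_cknD_le_of_index {S : Set (ℝ × EuclideanSpace ℝ (Fin 3))} {c : ℝ≥0}
    (h22 : ∀ (z : ℝ × EuclideanSpace ℝ (Fin 3)) (r ϱ : ℝ), 0 < ϱ → ϱ ≤ r → parabolicCylinder r z ⊆ S →
      cknD ϱ z p ≤ c * (ENNReal.ofReal (ϱ / r) * cknD r z p + ENNReal.ofReal ((r / ϱ) ^ 2) * cknC r z u))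
    {z₁ : ℝ × EuclideanSpace ℝ (Fin 3)} {R₀ : ℝ} (hR₀ : 0 < R₀) (hsub : parabolicCylinder R₀ z₁ ⊆ S)
    {σ : ℝ≥0} (hσ0 : 0 < σ) (hσ1 : σ < 1) (hcσ : c * σ ^ 2 ≤ 1 / 2) {a D₀ η : ℝ≥0}
    (hD : cknD R₀ z₁ p ≤ D₀)
    (hC : ∀ k : ℕ, cknC (((σ : ℝ) ^ k) ^ 2 * R₀) z₁ u ≤ ((a * epsHalfScale σ k : ℝ≥0) : ℝ≥0∞))
    {k : ℕ} (hk : decayMajorant c σ a D₀ k + a * epsHalfScale σ k ≤ η) :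
    cknC (((σ : ℝ) ^ k) ^ 2 * R₀) z₁ u + cknD (((σ : ℝ) ^ k) ^ 2 * R₀) z₁ p ≤ η :=
  calc cknC (((σ : ℝ) ^ k) ^ 2 * R₀) z₁ u + cknD (((σ : ℝ) ^ k) ^ 2 * R₀) z₁ p
      ≤ ((a * epsHalfScale σ k : ℝ≥0) : ℝ≥0∞) + (decayMajorant c σ a D₀ k : ℝ≥0∞) :=
        add_le_add (hC k) (cknD_le_decayMajorant h22 hR₀ hsub hσ0 hσ1 hcσ hD hC k)
    _ ≤ η := by rw [add_comm]; exact_mod_cast hk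

end Iteration

/-! ### The cubic functional under an essential bound -/

section Bounded

/-- **`C(r; z₁) ≤ |B₁| M³ r³` when `|u| ≤ M` a.e. on `Q_r(z₁)`** (`|Q_r| = r⁵ |B₁|`). [folklore] -/
theorem cknC_le_of_ae_bound {z₁ : ℝ × EuclideanSpace ℝ (Fin 3)} {r M : ℝ} (hr : 0 < r) (hM : 0 ≤ M)
    (hbd : ∀ᵐ z ∂(volume.restrict (parabolicCylinder r z₁)), ‖u z.1 z.2‖ ≤ M) :
    cknC r z₁ u ≤ ENNReal.ofReal (M ^ 3 * r ^ 3) * volume (ball (0 : EuclideanSpace ℝ (Fin 3)) 1) := by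
  have h1 : ∫⁻ z in parabolicCylinder r z₁, ‖u z.1 z.2‖ₑ ^ (3 : ℕ) ≤
      ∫⁻ _ in parabolicCylinder r z₁, ENNReal.ofReal (M ^ 3) := by
    refine lintegral_mono_ae ?_
    filter_upwards [hbd] with z hz
    rw [← ofReal_norm, ← ENNReal.ofReal_pow (norm_nonneg _)]
    exact ENNReal.ofReal_le_ofReal (pow_le_pow_left₀ (norm_nonneg _) hz 3)
  rw [lintegral_const, Measure.restrict_apply_univ, volume_parabolicCylinder_eq z₁ hr.le] at h1
  unfold cknC
  calc (ENNReal.ofReal r ^ 2)⁻¹ * ∫⁻ z in parabolicCylinder r z₁, ‖u z.1 z.2‖ₑ ^ (3 : ℕ)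
      ≤ (ENNReal.ofReal r ^ 2)⁻¹ * (ENNReal.ofReal (M ^ 3) * (ENNReal.ofReal (r ^ 5) *
          volume (ball (0 : EuclideanSpace ℝ (Fin 3)) 1))) := mul_le_mul' le_rfl h1
    _ = ENNReal.ofReal (M ^ 3 * r ^ 3) * volume (ball (0 : EuclideanSpace ℝ (Fin 3)) 1) := by
        rw [ofReal_pow_inv hr 2, ← mul_assoc, ← mul_assoc, ← ENNReal.ofReal_mul (by positivity),
          ← ENNReal.ofReal_mul (by positivity)]
        congr 2
        field_simp

/-- The same bound fed with the radii `r_k = σ^{2k} R₀` in the form `C(r_k; z₁) ≤ a s_k`,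
`a = (2 M³ R₀³) |B₁|`, `s_k = σ^k/2` (`σ^{6k} ≤ σ^k` for `σ ≤ 1`). [folklore] -/
theorem cknC_le_epsHalfScale {z₁ : ℝ × EuclideanSpace ℝ (Fin 3)} {R₀ M : ℝ} (hR₀ : 0 < R₀) (hM : 0 ≤ M)
    {σ : ℝ≥0} (hσ0 : 0 < σ) (hσ1 : σ ≤ 1)
    (hbd : ∀ᵐ z ∂(volume.restrict (parabolicCylinder R₀ z₁)), ‖u z.1 z.2‖ ≤ M) (k : ℕ) :
    cknC (((σ : ℝ) ^ k) ^ 2 * R₀) z₁ u ≤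
      ((Real.toNNReal (2 * M ^ 3 * R₀ ^ 3) * (volume (ball (0 : EuclideanSpace ℝ (Fin 3)) 1)).toNNReal *
        epsHalfScale σ k : ℝ≥0) : ℝ≥0∞) := by
  have hσR : (0 : ℝ) < σ := by exact_mod_cast hσ0
  have hσ1R : (σ : ℝ) ≤ 1 := by exact_mod_cast hσ1
  obtain ⟨hrk, hrkR⟩ := radius_pos_le hσR hσ1R hR₀ k
  have hsub : parabolicCylinder (((σ : ℝ) ^ k) ^ 2 * R₀) z₁ ⊆ parabolicCylinder R₀ z₁ := by
    refine prod_mono (Ioo_subset_Ioo ?_ le_rfl) (ball_subset_ball hrkR)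
    nlinarith [pow_le_pow_left₀ hrk.le hrkR 2]
  have hbd' : ∀ᵐ z ∂(volume.restrict (parabolicCylinder (((σ : ℝ) ^ k) ^ 2 * R₀) z₁)), ‖u z.1 z.2‖ ≤ M :=
    ae_restrict_of_ae_restrict_of_subset hsub hbd
  refine (cknC_le_of_ae_bound hrk hM hbd').trans ?_
  have hB : volume (ball (0 : EuclideanSpace ℝ (Fin 3)) 1) ≠ ⊤ := measure_ball_lt_top.ne
  -- `M³ r_k³ ≤ (2 M³ R₀³) s_k`
  have hpow : ((σ : ℝ) ^ k) ^ 6 ≤ (σ : ℝ) ^ k := by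
    have h1 : (σ : ℝ) ^ k ≤ 1 := pow_le_one₀ hσR.le hσ1R
    have h2 : 0 ≤ (σ : ℝ) ^ k := by positivity
    calc ((σ : ℝ) ^ k) ^ 6 = ((σ : ℝ) ^ k) ^ 5 * (σ : ℝ) ^ k := by ring
      _ ≤ 1 * (σ : ℝ) ^ k := by gcongr; exact pow_le_one₀ h2 h1
      _ = (σ : ℝ) ^ k := one_mul _
  have hkey : M ^ 3 * (((σ : ℝ) ^ k) ^ 2 * R₀) ^ 3 ≤ 2 * M ^ 3 * R₀ ^ 3 * ((σ : ℝ) ^ k / 2) := by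
    have : M ^ 3 * (((σ : ℝ) ^ k) ^ 2 * R₀) ^ 3 = (M ^ 3 * R₀ ^ 3) * ((σ : ℝ) ^ k) ^ 6 := by ring
    rw [this, show 2 * M ^ 3 * R₀ ^ 3 * ((σ : ℝ) ^ k / 2) = (M ^ 3 * R₀ ^ 3) * (σ : ℝ) ^ k by ring]
    exact mul_le_mul_of_nonneg_left hpow (by positivity)
  have es : ((epsHalfScale σ k : ℝ≥0) : ℝ≥0∞) = ENNReal.ofReal ((σ : ℝ) ^ k / 2) := by
    have h' : ((epsHalfScale σ k : ℝ≥0) : ℝ) = (σ : ℝ) ^ k / 2 := by simp [epsHalfScale]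
    rw [← ENNReal.ofReal_coe_nnreal, h']
  have e : ((Real.toNNReal (2 * M ^ 3 * R₀ ^ 3) * (volume (ball (0 : EuclideanSpace ℝ (Fin 3)) 1)).toNNReal *
        epsHalfScale σ k : ℝ≥0) : ℝ≥0∞) =
      ENNReal.ofReal (2 * M ^ 3 * R₀ ^ 3 * ((σ : ℝ) ^ k / 2)) * volume (ball (0 : EuclideanSpace ℝ (Fin 3)) 1) := by
    push_cast
    rw [ENNReal.coe_toNNReal hB, es, ENNReal.ofReal_mul (by positivity)]
    show ENNReal.ofReal (2 * M ^ 3 * R₀ ^ 3) * volume (ball (0 : EuclideanSpace ℝ (Fin 3)) 1) *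
        ENNReal.ofReal ((σ : ℝ) ^ k / 2) = _
    ring
  rw [e]
  exact mul_le_mul' (ENNReal.ofReal_le_ofReal hkey) le_rfl

end Bounded

/-! ### Around every point below the final time: the local smooth representative -/

section Local

/-- **Type I bounds the velocity below any negative time**: if `√(-t) |u| ≤ C` a.e. on `Q(0,3)`,
then on every measurable `K ⊆ Q(0,3)` whose times are `≤ T < 0`, `|u| ≤ max(0, C/√(-T))` a.e.
(Seregin–Šverák 2009: (r3) gives (b9), "`v ∈ L_∞(B × ]-1,-a²[)` for all `a ∈ ]0,1[`").
[cite: SereginSverak2009, §3 (r3) with §2 (b9)] -/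
theorem ae_norm_le_of_typeI {C T : ℝ} (hT : T < 0)
    (hI : ∀ᵐ z ∂(volume.restrict (parCyl (0 : ℝ × EuclideanSpace ℝ (Fin 3)) 3)),
      Real.sqrt (-z.1) * ‖u z.1 z.2‖ ≤ C)
    {K : Set (ℝ × EuclideanSpace ℝ (Fin 3))} (hKm : MeasurableSet K)
    (hK : K ⊆ parCyl (0 : ℝ × EuclideanSpace ℝ (Fin 3)) 3) (hKT : ∀ z ∈ K, z.1 ≤ T) :
    ∀ᵐ z ∂(volume.restrict K), ‖u z.1 z.2‖ ≤ max 0 (C / Real.sqrt (-T)) := by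
  filter_upwards [ae_restrict_of_ae_restrict_of_subset hK hI, ae_restrict_mem hKm] with z hz hzK
  have ht : z.1 ≤ T := hKT z hzK
  have hsT : 0 < Real.sqrt (-T) := Real.sqrt_pos.2 (by linarith)
  have hsz : Real.sqrt (-T) ≤ Real.sqrt (-z.1) := Real.sqrt_le_sqrt (by linarith)
  have hsz0 : 0 < Real.sqrt (-z.1) := hsT.trans_le hsz
  by_cases hC : 0 ≤ C
  · refine le_trans ?_ (le_max_right _ _)
    rw [le_div_iff₀ hsT]
    calc ‖u z.1 z.2‖ * Real.sqrt (-T) ≤ ‖u z.1 z.2‖ * Real.sqrt (-z.1) :=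
          mul_le_mul_of_nonneg_left hsz (norm_nonneg _)
      _ = Real.sqrt (-z.1) * ‖u z.1 z.2‖ := mul_comm _ _
      _ ≤ C := hz
  · exfalso
    exact hC ((mul_nonneg hsz0.le (norm_nonneg _)).trans hz)

/-- **Below the final time, a Type I axially symmetric solution is smooth in space, locally, with
all spatial derivatives Hölder continuous in space–time** (the regularity asserted in
Seregin–Šverák 2009, §2 p. 8 inside the region of essential boundedness, here obtained along
Seregin 2014, Lemma 6.1): around every point `z₀` of `Q(0,3)` with `t₀ < 0` there is an open
neighbourhood `N` on which `u` agrees a.e. with a field `V` whose slices are `C^∞` at the points of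
`N` and whose spatial derivatives of every order are Hölder continuous on `N`. Mechanism: the
Type I bound makes `|u| ≤ M` a.e. on a closed box `K` around `z₀` inside `Q(0,3) ∩ {t < t₀/2}`;
for centres `z₁ = (t₁, x₀)` with `t₁ ∈ [t₀, t₀ + δ²]` and the starting radius `R₀ = δ/2`
(`Q(z₁, R₀) ⊆ K`) the decay estimate for the pressure (`seregin_sverak_pressure_decay`, for the
distributional solution on `Q(0,3)`) iterated along `r_k = σ^{2k}R₀` with `C(r_k; z₁) ≤ 2|B₁|M³R₀³ s_k`
gives `C + D ≤ ε₀/2` at a scale `r = r_k` whose index depends only on `(c, σ, M, R₀, ∫_K |p|^{3/2}, ε₀)`;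
choosing `t₁ = t₀ + r²/8` puts `z₀` inside `Q(z₁, r/2)`; the pair is a suitable weak solution in
`Q(z₁, r)` (Remark 3.4, `SuitableOfBounded_holds`, and `IsSuitableWeakSolutionOn.isSuitableWeakSolutionInBall`),
its zoom to `Q(0,1)` satisfies (6.1.5), Lemma 6.1 (`seregin2014_lemma61`) provides the smooth
representative on `Q(0,1/2)`, and `exists_representative_of_zoom` transports it back to
`N = Q(z₁, r/2)`. [cite: SereginSverak2009, §2 p. 8 (regularity inside the region of essential boundedness); mechanism Seregin2014 Ch. 6 Lemma 6.1] -/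
theorem exists_local_smooth_representative (h22 : seregin_sverak_pressure_decay)
    (h61 : seregin2014_lemma61) (h3 : IsTypeIAxisymmetricSolutionOn 3 u p)
    {z₀ : ℝ × EuclideanSpace ℝ (Fin 3)} (hz₀ : z₀ ∈ parCyl (0 : ℝ × EuclideanSpace ℝ (Fin 3)) 3)
    (ht₀ : z₀.1 < 0) :
    ∃ N : Set (ℝ × EuclideanSpace ℝ (Fin 3)), IsOpen N ∧ z₀ ∈ N ∧
      ∃ V : ℝ → EuclideanSpace ℝ (Fin 3) → EuclideanSpace ℝ (Fin 3),
        uncurry u =ᵐ[volume.restrict N] uncurry V ∧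
        (∀ z ∈ N, ContDiffAt ℝ ∞ (V z.1) z.2) ∧
        ∀ k : ℕ, ∃ C α : ℝ≥0, 0 < α ∧
          HolderOnWith C α (fun z : ℝ × EuclideanSpace ℝ (Fin 3) => iteratedFDeriv ℝ k (V z.1) z.2) N := by
  -- the constants of the two facts and the ratio `σ`
  obtain ⟨c, h22⟩ := h22
  obtain ⟨ε₀, hε₀, c₀, h61⟩ := h61
  obtain ⟨σ, hσ0, hσ1, hcσ⟩ := exists_ratio_sq c
  have hσR : (0 : ℝ) < σ := by exact_mod_cast hσ0
  have hσ1R : (σ : ℝ) ≤ 1 := by exact_mod_cast hσ1.le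
  have hsuit : IsSuitableWeakSolutionOn (parCylOpens 0 3) 1 0 u p := h3.isSuitable SuitableOfBounded_holds
  have h22' : ∀ (z : ℝ × EuclideanSpace ℝ (Fin 3)) (r ϱ : ℝ), 0 < ϱ → ϱ ≤ r →
      parabolicCylinder r z ⊆ parCyl (0 : ℝ × EuclideanSpace ℝ (Fin 3)) 3 →
      cknD ϱ z p ≤ c * (ENNReal.ofReal (ϱ / r) * cknD r z p + ENNReal.ofReal ((r / ϱ) ^ 2) * cknC r z u) :=
    fun z r ϱ hϱ hϱr hsub => h22 (parCylOpens 0 3) u p h3.distributional z r ϱ hϱ hϱr hsub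
  -- a closed box `K` around `z₀` inside `Q(0,3) ∩ {t < t₀/2}`
  have hQ'open : IsOpen (parCyl (0 : ℝ × EuclideanSpace ℝ (Fin 3)) 3 ∩ {z | z.1 < z₀.1 / 2}) :=
    (isOpen_parCyl 0 3).inter (isOpen_lt continuous_fst continuous_const)
  have hz₀Q' : z₀ ∈ parCyl (0 : ℝ × EuclideanSpace ℝ (Fin 3)) 3 ∩ {z | z.1 < z₀.1 / 2} :=
    ⟨hz₀, by show z₀.1 < z₀.1 / 2; linarith⟩
  obtain ⟨δ, hδ, -, hbox⟩ := exists_closedCylinder_subset hQ'open hz₀Q'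
  have hKQ : Icc (z₀.1 - δ ^ 2) (z₀.1 + δ ^ 2) ×ˢ closedBall z₀.2 δ ⊆
      parCyl (0 : ℝ × EuclideanSpace ℝ (Fin 3)) 3 := fun z hz => (hbox hz).1
  have hKT : ∀ z ∈ Icc (z₀.1 - δ ^ 2) (z₀.1 + δ ^ 2) ×ˢ closedBall z₀.2 δ, z.1 ≤ z₀.1 / 2 :=
    fun z hz => le_of_lt (hbox hz).2
  have hKm : MeasurableSet (Icc (z₀.1 - δ ^ 2) (z₀.1 + δ ^ 2) ×ˢ closedBall z₀.2 δ) :=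
    measurableSet_Icc.prod measurableSet_closedBall
  -- the essential bound `M` on `K`
  obtain ⟨CI, hI⟩ := h3.typeI
  obtain ⟨M, hM0, hbdK⟩ : ∃ M : ℝ, 0 ≤ M ∧
      ∀ᵐ z ∂(volume.restrict (Icc (z₀.1 - δ ^ 2) (z₀.1 + δ ^ 2) ×ˢ closedBall z₀.2 δ)), ‖u z.1 z.2‖ ≤ M :=
    ⟨max 0 (CI / Real.sqrt (-(z₀.1 / 2))), le_max_left _ _,
      ae_norm_le_of_typeI (by linarith) hI hKm hKQ hKT⟩
  -- the starting radius `R₀ = δ/2` and the data `(a, D₀, η)` of the iteration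
  obtain ⟨R₀, hR₀⟩ : ∃ R₀ : ℝ, R₀ = δ / 2 := ⟨_, rfl⟩
  have hR₀pos : 0 < R₀ := by rw [hR₀]; positivity
  have hR₀δ : R₀ ≤ δ := by rw [hR₀]; linarith
  have hBtop : volume (ball (0 : EuclideanSpace ℝ (Fin 3)) 1) ≠ ⊤ := measure_ball_lt_top.ne
  have hPK : ∫⁻ z in Icc (z₀.1 - δ ^ 2) (z₀.1 + δ ^ 2) ×ˢ closedBall z₀.2 δ, ‖p z.1 z.2‖ₑ ^ (3 / 2 : ℝ) < ⊤ :=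
    (lintegral_mono_set hKQ).trans_lt h3.pressure_L32
  obtain ⟨D₀, hD₀coe⟩ : ∃ D₀ : ℝ≥0, (D₀ : ℝ≥0∞) = (ENNReal.ofReal R₀ ^ 2)⁻¹ *
      ∫⁻ z in Icc (z₀.1 - δ ^ 2) (z₀.1 + δ ^ 2) ×ˢ closedBall z₀.2 δ, ‖p z.1 z.2‖ₑ ^ (3 / 2 : ℝ) :=
    ⟨_, ENNReal.coe_toNNReal (ENNReal.mul_ne_top (ENNReal.inv_ne_top.2 (by positivity)) hPK.ne)⟩
  have hη0 : 0 < Real.toNNReal (ε₀ / 2) := Real.toNNReal_pos.2 (by positivity)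
  have hηcoe : ((Real.toNNReal (ε₀ / 2) : ℝ≥0) : ℝ≥0∞) = ENNReal.ofReal (ε₀ / 2) := rfl
  obtain ⟨k, hk⟩ := exists_decayMajorant_add_le c
    (Real.toNNReal (2 * M ^ 3 * R₀ ^ 3) * (volume (ball (0 : EuclideanSpace ℝ (Fin 3)) 1)).toNNReal)
    D₀ hσ1 hη0
  -- the scale `r = σ^{2k} R₀` and the centre `z₁ = (t₀ + r²/8, x₀)`
  obtain ⟨r, hr⟩ : ∃ r : ℝ, r = ((σ : ℝ) ^ k) ^ 2 * R₀ := ⟨_, rfl⟩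
  have hrpos : 0 < r := by rw [hr]; exact (radius_pos_le hσR hσ1R hR₀pos k).1
  have hrR₀ : r ≤ R₀ := by rw [hr]; exact (radius_pos_le hσR hσ1R hR₀pos k).2
  have hrδ : r ≤ δ := hrR₀.trans hR₀δ
  have hr2 : r ^ 2 ≤ δ ^ 2 / 4 := by
    have : r ^ 2 ≤ R₀ ^ 2 := pow_le_pow_left₀ hrpos.le hrR₀ 2
    rw [hR₀] at this
    linarith
  obtain ⟨z₁, hz₁⟩ : ∃ z₁ : ℝ × EuclideanSpace ℝ (Fin 3), z₁ = (z₀.1 + r ^ 2 / 8, z₀.2) := ⟨_, rfl⟩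
  have hz₁1 : z₁.1 = z₀.1 + r ^ 2 / 8 := by rw [hz₁]
  have hz₁2 : z₁.2 = z₀.2 := by rw [hz₁]
  -- `Q(z₁, R₀) ⊆ K`, and the closed box of `Q(z₁, r)` lies in `Q(0,3)`
  have hQR₀ : parabolicCylinder R₀ z₁ ⊆ Icc (z₀.1 - δ ^ 2) (z₀.1 + δ ^ 2) ×ˢ closedBall z₀.2 δ := by
    rintro ⟨t, x⟩ hw
    rw [mem_parabolicCylinder] at hw
    obtain ⟨⟨h1, h2⟩, h3'⟩ := hw
    rw [hz₁1] at h1 h2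
    rw [hz₁2] at h3'
    have hR₀2 : R₀ ^ 2 = δ ^ 2 / 4 := by rw [hR₀]; ring
    refine ⟨⟨?_, ?_⟩, ?_⟩
    · show z₀.1 - δ ^ 2 ≤ t
      nlinarith
    · show t ≤ z₀.1 + δ ^ 2
      nlinarith
    · exact mem_closedBall.2 ((mem_ball.1 h3').le.trans hR₀δ)
  have hboxr : Icc (z₁.1 - r ^ 2) z₁.1 ×ˢ closedBall z₁.2 r ⊆ (parCylOpens (0 : ℝ × EuclideanSpace ℝ (Fin 3)) 3 :
      Set (ℝ × EuclideanSpace ℝ (Fin 3))) := by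
    refine Subset.trans ?_ hKQ
    rintro ⟨t, x⟩ ⟨ht, hx⟩
    rw [hz₁1, mem_Icc] at ht
    rw [hz₁2] at hx
    refine ⟨⟨?_, ?_⟩, closedBall_subset_closedBall hrδ hx⟩
    · show z₀.1 - δ ^ 2 ≤ t
      nlinarith [ht.1]
    · show t ≤ z₀.1 + δ ^ 2
      nlinarith [ht.2]
  -- the iteration at `z₁`: `C + D ≤ ε₀/2` at the scale `r`
  have hbd₁ : ∀ᵐ z ∂(volume.restrict (parabolicCylinder R₀ z₁)), ‖u z.1 z.2‖ ≤ M :=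
    ae_restrict_of_ae_restrict_of_subset hQR₀ hbdK
  have hC : ∀ j : ℕ, cknC (((σ : ℝ) ^ j) ^ 2 * R₀) z₁ u ≤
      ((Real.toNNReal (2 * M ^ 3 * R₀ ^ 3) * (volume (ball (0 : EuclideanSpace ℝ (Fin 3)) 1)).toNNReal *
        epsHalfScale σ j : ℝ≥0) : ℝ≥0∞) :=
    fun j => cknC_le_epsHalfScale hR₀pos hM0 hσ0 hσ1.le hbd₁ j
  have hD : cknD R₀ z₁ p ≤ D₀ := by
    rw [hD₀coe]
    exact mul_le_mul' le_rfl (lintegral_mono_set hQR₀)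
  have hsmallCD : cknC r z₁ u + cknD r z₁ p ≤ Real.toNNReal (ε₀ / 2) := by
    rw [hr]
    exact cknC_add_cknD_le_of_index h22' hR₀pos (hQR₀.trans hKQ) hσ0 hσ1 hcσ hD hC hk
  -- the zoomed pair in the class of Lemma 6.1, and the smallness (6.1.5)
  have hball := (hsuit.isSuitableWeakSolutionInBall hboxr).zoom hrpos
  have hmeas : AEMeasurable (fun w : ℝ × EuclideanSpace ℝ (Fin 3) =>
      ‖(r • stPull (r ^ 2) r z₁.1 z₁.2 u) w.1 w.2‖ₑ ^ (3 : ℕ))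
      (volume.restrict (parabolicCylinder 1 (0 : ℝ × EuclideanSpace ℝ (Fin 3)))) :=
    (hball.1.distributional.1.aestronglyMeasurable.enorm.pow_const _)
  have hsmall : ∫⁻ w in parabolicCylinder 1 (0 : ℝ × EuclideanSpace ℝ (Fin 3)),
      (‖(r • stPull (r ^ 2) r z₁.1 z₁.2 u) w.1 w.2‖ₑ ^ (3 : ℕ) +
        ‖(r ^ 2 • stPull (r ^ 2) r z₁.1 z₁.2 p) w.1 w.2‖ₑ ^ (3 / 2 : ℝ)) < ENNReal.ofReal ε₀ := by
    rw [lintegral_add_left' hmeas, lintegral_cube_zoom hrpos z₁ u, lintegral_pressure_zoom hrpos z₁ p]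
    refine hsmallCD.trans_lt ?_
    rw [hηcoe]
    exact (ENNReal.ofReal_lt_ofReal_iff hε₀).2 (by linarith)
  obtain ⟨W, hW, hcd, hk61⟩ := h61 _ _ hball hsmall
  obtain ⟨V, hV1, hV2, hV3, -⟩ := exists_representative_of_zoom hrpos z₁ hW hcd
    (fun j => (hk61 j).1) (fun j => (hk61 j).2)
  refine ⟨parabolicCylinder (r / 2) z₁, isOpen_parabolicCylinder _ _, ?_, V, hV1, hV2, hV3⟩
  rw [mem_parabolicCylinder, hz₁1, hz₁2, dist_self]
  exact ⟨⟨by nlinarith, by nlinarith⟩, half_pos hrpos⟩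

end Local

/-! ### Gluing, symmetry by continuity, and `OffAxisSmoothRepresentative` -/

section Glue

/-- A field whose `0`-th spatial derivative is Hölder continuous in space–time on `N` is
continuous on `N` (as a function of `(t, x)`). [folklore] -/
theorem continuousOn_uncurry_of_holder {V : ℝ → EuclideanSpace ℝ (Fin 3) → EuclideanSpace ℝ (Fin 3)}
    {N : Set (ℝ × EuclideanSpace ℝ (Fin 3))} {C α : ℝ≥0} (hα : 0 < α)
    (h : HolderOnWith C α (fun z : ℝ × EuclideanSpace ℝ (Fin 3) => iteratedFDeriv ℝ 0 (V z.1) z.2) N) :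
    ContinuousOn (uncurry V) N := by
  have h0 := h.continuousOn hα
  have heq : uncurry V = (continuousMultilinearCurryFin0 ℝ (EuclideanSpace ℝ (Fin 3)) (EuclideanSpace ℝ (Fin 3))) ∘
      fun w : ℝ × EuclideanSpace ℝ (Fin 3) => iteratedFDeriv ℝ 0 (V w.1) w.2 := by
    funext w
    simp only [comp_apply, uncurry]
    rfl
  rw [heq]
  exact (continuousMultilinearCurryFin0 ℝ (EuclideanSpace ℝ (Fin 3)) (EuclideanSpace ℝ (Fin 3))).continuous.comp_continuousOn h0

/-- Slices of an open set are open, and an identity `v = V` on an open set `O` gives, at every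
point `w ∈ O`, the eventual identity of the slices `x ↦ v(t, x)` and `V t` near `x = w.2`. [folklore] -/
theorem slice_eventuallyEq {v : ℝ × EuclideanSpace ℝ (Fin 3) → EuclideanSpace ℝ (Fin 3)}
    {Vz : ℝ → EuclideanSpace ℝ (Fin 3) → EuclideanSpace ℝ (Fin 3)} {O : Set (ℝ × EuclideanSpace ℝ (Fin 3))}
    (hO : IsOpen O) (heq : EqOn v (uncurry Vz) O) {w : ℝ × EuclideanSpace ℝ (Fin 3)} (hw : w ∈ O) :
    (fun x => v (w.1, x)) =ᶠ[𝓝 w.2] Vz w.1 := by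
  have hmk : Continuous fun x : EuclideanSpace ℝ (Fin 3) => ((w.1, x) : ℝ × EuclideanSpace ℝ (Fin 3)) :=
    continuous_const.prodMk continuous_id
  have hopen : IsOpen {x : EuclideanSpace ℝ (Fin 3) | (w.1, x) ∈ O} := hO.preimage hmk
  have hmem : w.2 ∈ {x : EuclideanSpace ℝ (Fin 3) | (w.1, x) ∈ O} := by
    show (w.1, w.2) ∈ O
    exact hw
  exact eventuallyEq_of_mem (hopen.mem_nhds hmem) fun x hx => heq hx

/-- **Axial symmetry passes to the continuous representative.** On an open set `U` invariant under
the rotations `(t, x) ↦ (t, R_θ x)`, if the slices of `u` are axially symmetric at the points of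
`U` and `v` is a continuous function on `U` equal to `u` a.e. there, then `v` is axially symmetric
at the points of `U`: `v(t, R_θ x) = R_θ v(t, x)` holds a.e. on `U` (the rotation preserves
Lebesgue measure), and both sides are continuous on `U`. [folklore] -/
theorem isAxisymmetricOn_of_ae_eq {U : Set (ℝ × EuclideanSpace ℝ (Fin 3))} (hUo : IsOpen U)
    (hUrot : ∀ θ : ℝ, ∀ z ∈ U, ((z.1, rotZ θ z.2) : ℝ × EuclideanSpace ℝ (Fin 3)) ∈ U)
    (hax : ∀ z ∈ U, ∀ θ : ℝ, u z.1 (rotZ θ z.2) = rotZ θ (u z.1 z.2))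
    {v : ℝ × EuclideanSpace ℝ (Fin 3) → EuclideanSpace ℝ (Fin 3)} (hv : ContinuousOn v U)
    (hae : uncurry u =ᵐ[volume.restrict U] v) :
    IsAxisymmetricOn U fun t x => v (t, x) := by
  intro θ z hz
  -- the measure-preserving rotation of space–time
  set Ψ : ℝ × EuclideanSpace ℝ (Fin 3) → ℝ × EuclideanSpace ℝ (Fin 3) := Prod.map id (rotZLIE θ) with hΨdef
  have hΨ : ∀ w, Ψ w = (w.1, rotZ θ w.2) := fun w => rfl
  have hΨmp : MeasurePreserving Ψ (volume : Measure (ℝ × EuclideanSpace ℝ (Fin 3))) volume :=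
    (MeasurePreserving.id (volume : Measure ℝ)).prod (rotZLIE θ).measurePreserving
  have hΨc : Continuous Ψ := continuous_id.prodMap (rotZLIE θ).continuous
  -- the two continuous functions `v ∘ Ψ` and `R_θ ∘ v` agree a.e. on `U`
  have hF₁ : ContinuousOn (fun w => v (Ψ w)) U := hv.comp hΨc.continuousOn fun w hw => hUrot θ w hw
  have hF₂ : ContinuousOn (fun w => rotZ θ (v w)) U := (rotZLIE θ).continuous.comp_continuousOn hv
  have hUm : MeasurableSet U := hUo.measurableSet
  have hae' : ∀ᵐ w ∂(volume : Measure (ℝ × EuclideanSpace ℝ (Fin 3))), w ∈ U → uncurry u w = v w :=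
    (ae_restrict_iff' hUm).1 hae
  have hae'' : ∀ᵐ w ∂(volume : Measure (ℝ × EuclideanSpace ℝ (Fin 3))), Ψ w ∈ U → uncurry u (Ψ w) = v (Ψ w) :=
    hΨmp.quasiMeasurePreserving.ae hae'
  have haeU : (fun w => v (Ψ w)) =ᵐ[volume.restrict U] fun w => rotZ θ (v w) := by
    refine (ae_restrict_iff' hUm).2 ?_
    filter_upwards [hae', hae''] with w h1 h2 hwU
    have e1 : v (Ψ w) = uncurry u (Ψ w) := (h2 (hUrot θ w hwU)).symm
    have e2 : v w = uncurry u w := (h1 hwU).symm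
    rw [e1, e2, hΨ]
    simp only [uncurry]
    exact hax w hwU θ
  have heq := Measure.eqOn_open_of_ae_eq haeU hUo hF₁ hF₂
  have := heq hz
  simp only [hΨ] at this
  exact this

/-- **Seregin–Šverák 2009, §2 p. 8 / Remark 3.4: off the axis, the pairs under the conditions of
Theorem 3.1 are "sufficiently smooth" — `OffAxisSmoothRepresentative` proved from the decay
estimate for the pressure and Seregin 2014, Lemma 6.1.** For `(u, p)` in
`IsTypeIAxisymmetricSolutionOn 3`, around every point of the shell `Q̃ = 𝒞(1/4,3;2) × ]-2²,0[`
(times `< 0`) `exists_local_smooth_representative` gives an open neighbourhood and a smooth local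
representative; the local representatives are continuous, hence glue to one continuous `v` on
`Q̃` (`exists_continuousOn_ae_eq_of_locally`), which coincides with each of them on its domain
(continuous functions a.e. equal on an open set are equal), so that `V(t, x) = v(t, x)` has smooth
slices and locally Hölder continuous spatial derivatives of every order at the points of `Q̃`;
`V` is axially symmetric at the points of `Q̃` because `u` is, slice by slice, and `V` is
continuous (`isAxisymmetricOn_of_ae_eq`); and `(V, p)` is a suitable weak solution on `Q̃`
because `(u, p)` is one on `Q(0,3) ⊇ Q̃` (Remark 3.4, `SuitableOfBounded_holds`, transported by
`IsTypeIAxisymmetricSolutionOn.isSuitable`) and suitability does not see null sets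
(`IsSuitableWeakSolutionOn.congr_ae`).
[cite: SereginSverak2009, §2 p. 8 (regularity inside the region of essential boundedness) with Remark 3.4; mechanism Seregin2014 Ch. 6 Lemma 6.1] -/
theorem offAxisSmoothRepresentative_of (h22 : seregin_sverak_pressure_decay)
    (h61 : seregin2014_lemma61) : OffAxisSmoothRepresentative := by
  intro u p h3
  set U : Set (ℝ × EuclideanSpace ℝ (Fin 3)) := shellCyl (1 / 4) 3 2 2 with hU
  have hUo : IsOpen U := isOpen_shellCyl _ _ _ _
  have hU3 : U ⊆ parCyl (0 : ℝ × EuclideanSpace ℝ (Fin 3)) 3 := by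
    intro z hz
    have hz' : z ∈ outerShell 1 0 := by rw [outerShell_one_eq]; exact hz
    exact outerShell_one_subset hz'
  have hUt : ∀ z ∈ U, z.1 < 0 := fun z hz => (mem_shellCyl.1 hz).1.2
  -- local smooth representatives around the points of `U`
  have hloc : ∀ z ∈ U, ∃ N : Set (ℝ × EuclideanSpace ℝ (Fin 3)), IsOpen N ∧ z ∈ N ∧
      ∃ Vz : ℝ → EuclideanSpace ℝ (Fin 3) → EuclideanSpace ℝ (Fin 3),
        uncurry u =ᵐ[volume.restrict N] uncurry Vz ∧
        (∀ w ∈ N, ContDiffAt ℝ ∞ (Vz w.1) w.2) ∧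
        ∀ k : ℕ, ∃ C α : ℝ≥0, 0 < α ∧
          HolderOnWith C α (fun w : ℝ × EuclideanSpace ℝ (Fin 3) => iteratedFDeriv ℝ k (Vz w.1) w.2) N :=
    fun z hz => exists_local_smooth_representative h22 h61 h3 (hU3 hz) (hUt z hz)
  choose! N hNo hzN Vloc hV1 hV2 hV3 using hloc
  have hcontloc : ∀ z ∈ U, ContinuousOn (uncurry (Vloc z)) (N z) := by
    intro z hz
    obtain ⟨C, α, hα, hH⟩ := hV3 z hz 0
    exact continuousOn_uncurry_of_holder hα hH
  -- gluing
  have hloc2 : ∀ z ∈ U, ∃ O : Set (ℝ × EuclideanSpace ℝ (Fin 3)), IsOpen O ∧ z ∈ O ∧ O ⊆ U ∧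
      ∃ g : ℝ × EuclideanSpace ℝ (Fin 3) → EuclideanSpace ℝ (Fin 3),
        ContinuousOn g O ∧ uncurry u =ᵐ[volume.restrict O] g := by
    intro z hz
    refine ⟨N z ∩ U, (hNo z hz).inter hUo, ⟨hzN z hz, hz⟩, inter_subset_right, uncurry (Vloc z),
      (hcontloc z hz).mono inter_subset_left, ?_⟩
    exact ae_restrict_of_ae_restrict_of_subset inter_subset_left (hV1 z hz)
  obtain ⟨v, hv, huv⟩ := exists_continuousOn_ae_eq_of_locally (μ := volume) hloc2
  -- `v` coincides with each local representative on its domain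
  have hvloc : ∀ z ∈ U, EqOn v (uncurry (Vloc z)) (N z ∩ U) := by
    intro z hz
    have a1 : uncurry u =ᵐ[volume.restrict (N z ∩ U)] v :=
      ae_restrict_of_ae_restrict_of_subset inter_subset_right huv
    have a2 : uncurry u =ᵐ[volume.restrict (N z ∩ U)] uncurry (Vloc z) :=
      ae_restrict_of_ae_restrict_of_subset inter_subset_left (hV1 z hz)
    have h1 : v =ᵐ[volume.restrict (N z ∩ U)] uncurry (Vloc z) := a1.symm.trans a2
    exact Measure.eqOn_open_of_ae_eq h1 ((hNo z hz).inter hUo) (hv.mono inter_subset_right)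
      ((hcontloc z hz).mono inter_subset_left)
  set V : ℝ → EuclideanSpace ℝ (Fin 3) → EuclideanSpace ℝ (Fin 3) := fun t x => v (t, x) with hV
  have hVslice : ∀ z ∈ U, ∀ w ∈ N z ∩ U, V w.1 =ᶠ[𝓝 w.2] Vloc z w.1 :=
    fun z hz w hw => slice_eventuallyEq ((hNo z hz).inter hUo) (hvloc z hz) hw
  -- suitability on the shell
  have hsuit : IsSuitableWeakSolutionOn (shellCylOpens (1 / 4) 3 2 2) 1 0 u p :=
    (h3.isSuitable SuitableOfBounded_holds).of_le hU3
  have huV : ∀ᵐ z ∂(volume.restrict (shellCyl (1 / 4) 3 2 2)), uncurry u z = uncurry V z := by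
    filter_upwards [huv] with z hz
    rw [hz]
    rfl
  refine ⟨V, ⟨hsuit.congr_ae huV (Eventually.of_forall fun _ => rfl), ?_, ?_, ?_⟩, huV⟩
  · -- axial symmetry of the continuous representative
    refine isAxisymmetricOn_of_ae_eq hUo (fun θ z hz => ?_) (fun z hz θ => ?_) hv huv
    · rw [hU, mem_shellCyl] at hz ⊢
      obtain ⟨ht, hsh⟩ := hz
      have hsh' : rotZ θ z.2 ∈ shell (1 / 4) 3 2 := (rotZ_mem_shell_iff θ).2 hsh
      exact ⟨ht, hsh'⟩
    · have ht : z.1 ∈ Ioo (-(3 : ℝ) ^ 2) 0 := by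
        obtain ⟨⟨h1, h2⟩, -⟩ := mem_shellCyl.1 hz
        exact ⟨by nlinarith, h2⟩
      exact h3.axisymmetric z.1 ht θ z.2
  · -- smooth slices
    intro z hz
    have h := hV2 z hz z (hzN z hz)
    exact h.congr_of_eventuallyEq (hVslice z hz z ⟨hzN z hz, hz⟩)
  · -- locally Hölder continuous spatial derivatives
    intro n z hz
    obtain ⟨C, α, hα, hH⟩ := hV3 z hz n
    refine ⟨N z ∩ U, ((hNo z hz).inter hUo).mem_nhds ⟨hzN z hz, hz⟩, C, α, hα, ?_⟩
    intro w hw w' hw'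
    have hwN : w ∈ N z ∩ U := hw.1
    have hw'N : w' ∈ N z ∩ U := hw'.1
    have e : ∀ y ∈ N z ∩ U, iteratedFDeriv ℝ n (V y.1) y.2 = iteratedFDeriv ℝ n (Vloc z y.1) y.2 :=
      fun y hy => ((hVslice z hz y hy).iteratedFDeriv ℝ n).eq_of_nhds
    show edist (iteratedFDeriv ℝ n (V w.1) w.2) (iteratedFDeriv ℝ n (V w'.1) w'.2) ≤ _
    rw [e w hwN, e w' hw'N]
    exact hH w hwN.1 w' hw'N.1

end Glue

end SereginSverak2009

end Literature.Analysis.FluidPDE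

end
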